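import Mathlib
import HarnessLib
import Summits.NavierStokesRegularity.NavierStokesRegularity.Theorems.PoloidalWindowDoorLrcModEntireTwistingTHOscUniversalWeightGlue

/-!
# Item `LrcModEntire` (stmt-NavierStokesRegularity-20428), CLASS road to `stub_twistingTHGerm` — an EXPLICIT UNIVERSAL LYAPUNOV
# WEIGHT for the plane-oscillation law (OSC) in similarity variables (every compression constant, every `A = 2N`) — part 3/3: the PROPERTIES and the main theorem

Cell ns-regularity-ideate, LEAD ns-poloidal-K2-p3 g13 (`--supports stmt-NavierStokesRegularity-20428`; brick (K-w) of the kernel plan agreed with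
ns-k2-port-2 g3, OSC-SCALING-NOTE v2 §3 / OSC-LIOUVILLE-g13 §3, crux dir).

THE POINT.  In similarity variables the law (OSC) is `∂_τÔ + ½∂_ξ((ξ + Ŝ)Ô) ≤ ∂_ξξÔ` with `|Ŝ| ≤ A`.  A weight `w > 0` with
(UW) `w″(ξ) + ½(ξ + s)·w′(ξ) ≤ −γ·w(ξ)` for ALL `ξ` and ALL `|s| ≤ A` (one `γ > 0`), plus Gaussian decay of `w, w′`, makes `M(τ) := ∫Ô w` satisfy
`M′ ≤ −γM` by two integrations by parts, whence the ancient Liouville theorem for (OSC) for EVERY Lipschitz constant of `Ŝ` (port-2's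
(K-b)/(K-c)).  Port-2 obtains such a `w` as the principal Neumann eigenfunction of `w″ + ½(ξ−A)w′` (Sturm–Liouville).  This file REMOVES the
spectral input: an explicit, elementary, even `C²` weight works, with `γ = e^{−A²/2}/16`:
* on `[0, A]`:  `w(ξ) = 1 − γ·H(ξ)`, `H(ξ) = (2/A)((2/A)(e^{Aξ/2} − 1) − ξ)` (so `w′ = −γh`, `h = (2/A)(e^{Aξ/2} − 1)`, `w″ = −γe^{Aξ/2}`, and
  `w″ + ½(ξ−A)w′ = −γ(1 + (ξ/A)(e^{Aξ/2} − 1)) ≤ −γ ≤ −γw` — the point being `h′ − ½(A−ξ)h ≥ 1`);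
* on `[A, ∞)`: the `C²`-matched tail `w(ξ) = W_A·exp(−λu − κu²)`, `u = ξ − A`, `λ = γh(A)/W_A`, `κ = (λ² + γe^{A²/2}/W_A)/2 ≤ 1/8`;
* even extension to `ξ < 0`; worst case `s = −A` suffices on `ξ ≥ 0` because `w′ ≤ 0` there.
Main theorem: `exists_universalWeight` — for every `A > 0` there are `γ, κ > 0`, `C ≥ 0` and an even `C²` weight `w > 0`, non-increasing on
`[0,∞)`, with (UW) and `|w|, |w′| ≤ C·e^{−κξ²}` — exactly the hypothesis object of port-2's (K-b).

WHAT THIS IS NOT: not a claim about Navier–Stokes regularity and not the stub — one-variable real analysis (bears_on LADDER-NS N0, item 20428 / crux 19708;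
both OPEN).
-/

noncomputable section

-- the summit and its single sub-problem share the name (CONVENTIONS §1), as in every Theorems file
set_option linter.dupNamespace false

namespace Summit.NavierStokesRegularity.NavierStokesRegularity.Theorems.PoloidalWindowDoorLrcModEntireTwistingTHOscUniversalWeight

open Set Filter Topology MeasureTheory intervalIntegral
open Summit.NavierStokesRegularity.NavierStokesRegularity.Theorems.PoloidalWindowDoorLrcModEntireTwistingTHOscUniversalWeightDefs
open Summit.NavierStokesRegularity.NavierStokesRegularity.Theorems.PoloidalWindowDoorLrcModEntireTwistingTHOscUniversalWeightPieces
open Summit.NavierStokesRegularity.NavierStokesRegularity.Theorems.PoloidalWindowDoorLrcModEntireTwistingTHOscUniversalWeightGlue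

variable {A : ℝ}
/-! ### The properties on `[0, ∞)` -/

/-- `w_L ≤ 1` on `[0,∞)`. -/
theorem wL_le_one (hA : 0 < A) (ξ : ℝ) : wL A ξ ≤ 1 := by
  unfold wL; linarith [mul_nonneg (gam_pos (A := A)).le (Hf_nonneg hA ξ)]

/-- `w_L > 0` on `[0,A]`. -/
theorem wL_pos (hA : 0 < A) {ξ : ℝ} (hξ : 0 ≤ ξ) (hξA : ξ ≤ A) : 0 < wL A ξ := by
  unfold wL; linarith [gam_Hf_le hA hξ hξA]

/-- `w_R > 0`. -/
theorem wR_pos (hA : 0 < A) (ξ : ℝ) : 0 < wR A ξ := by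
  unfold wR; exact mul_pos (WA_pos hA) (Real.exp_pos _)

/-- Positivity on `[0,∞)`. -/
theorem wf_pos_of_nonneg (hA : 0 < A) {ξ : ℝ} (hξ : 0 ≤ ξ) : 0 < wf A ξ := by
  by_cases h : ξ ≤ A
  · rw [wf_of_mem hA hξ h]; exact wL_pos hA hξ h
  · rw [wf_of_ge hA (le_of_not_ge h)]; exact wR_pos hA ξ

/-- Monotonicity on `[0,∞)`: `w′ ≤ 0`. -/
theorem w1_nonpos_of_nonneg (hA : 0 < A) {ξ : ℝ} (hξ : 0 ≤ ξ) : w1 A ξ ≤ 0 := by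
  by_cases h : ξ ≤ A
  · rw [w1_of_mem hA hξ h]
    have := hf_nonneg hA hξ
    have := gam_pos (A := A)
    nlinarith
  · have hge : A ≤ ξ := le_of_not_ge h
    rw [w1_of_ge hA hge]
    unfold wR1
    have h1 : 0 ≤ lam A + 2 * kap A * (ξ - A) := by
      have := lam_nonneg hA; have := kap_pos hA; nlinarith
    have h2 := wR_pos hA ξ
    nlinarith

/-- **(UW) on `[0, A]`.** -/
theorem ineq_left (hA : 0 < A) {ξ s : ℝ} (hξ : 0 ≤ ξ) (hs : |s| ≤ A) :
    gL A ξ + (1 / 2) * (ξ + s) * (-gam A * hf A ξ) ≤ -gam A * wL A ξ := by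
  have hg := gam_pos (A := A)
  have hh := hf_nonneg hA hξ
  have hw1 := wL_le_one hA ξ
  have hsA : -A ≤ s := (abs_le.1 hs).1
  -- replace `s` by the worst case `−A`
  have hc : -gam A * hf A ξ ≤ 0 := by nlinarith [mul_nonneg hg.le hh]
  have h1' := mul_le_mul_of_nonpos_right (show ξ - A ≤ ξ + s by linarith) hc
  have h1 : (1 / 2) * (ξ + s) * (-gam A * hf A ξ) ≤ (1 / 2) * (ξ - A) * (-gam A * hf A ξ) := by nlinarith [h1']
  -- the identity `e^{Aξ/2} + ((ξ−A)/A)(e^{Aξ/2} − 1) = 1 + (ξ/A)(e^{Aξ/2} − 1)`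
  have hex : 1 ≤ Real.exp (A * ξ / 2) := Real.one_le_exp (by positivity)
  have h2 : gL A ξ + (1 / 2) * (ξ - A) * (-gam A * hf A ξ) = -gam A * (1 + (ξ / A) * (Real.exp (A * ξ / 2) - 1)) := by
    unfold gL hf; field_simp; ring
  have h3 : 0 ≤ (ξ / A) * (Real.exp (A * ξ / 2) - 1) := mul_nonneg (by positivity) (by linarith)
  calc gL A ξ + (1 / 2) * (ξ + s) * (-gam A * hf A ξ)
      ≤ gL A ξ + (1 / 2) * (ξ - A) * (-gam A * hf A ξ) := by linarith [h1]
    _ = -gam A * (1 + (ξ / A) * (Real.exp (A * ξ / 2) - 1)) := h2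
    _ ≤ -gam A * 1 := by nlinarith [h3, hg]
    _ ≤ -gam A * wL A ξ := by nlinarith [hw1, hg]

/-- **(UW) on `[A, ∞)`.** -/
theorem ineq_right (hA : 0 < A) {ξ s : ℝ} (hξA : A ≤ ξ) (hs : |s| ≤ A) :
    wR2 A ξ + (1 / 2) * (ξ + s) * wR1 A ξ ≤ -gam A * wR A ξ := by
  have hsA : -A ≤ s := (abs_le.1 hs).1
  have hw := wR_pos hA ξ
  have hl0 := lam_nonneg hA
  have hk0 := kap_pos hA
  have hk8 := kap_le hA
  set u := ξ - A with hu
  have hu0 : 0 ≤ u := by rw [hu]; linarith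
  set p := lam A + 2 * kap A * u with hp
  have hp0 : 0 ≤ p := by rw [hp]; positivity
  -- worst case `s = −A`: `½(ξ+s)·wR1 ≤ ½u·wR1` since `wR1 = −p·wR ≤ 0`
  have hwR1 : wR1 A ξ = -p * wR A ξ := by unfold wR1; rfl
  have h1 : (1 / 2) * (ξ + s) * wR1 A ξ ≤ (1 / 2) * u * wR1 A ξ := by
    rw [hwR1]; nlinarith [mul_nonneg hp0 hw.le]
  have hwR2 : wR2 A ξ = (p ^ 2 - 2 * kap A) * wR A ξ := by unfold wR2; rfl
  -- `p² − 2κ − ½u p = (λ² − 2κ) + u(4λκ − λ/2) + u²(4κ² − κ)` and each correction is `≤ 0`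
  have hid : p ^ 2 - 2 * kap A - (1 / 2) * u * p =
      (lam A ^ 2 - 2 * kap A) + u * (4 * lam A * kap A - lam A / 2) + u ^ 2 * (4 * kap A ^ 2 - kap A) := by
    rw [hp]; ring
  have hc1 : u * (4 * lam A * kap A - lam A / 2) ≤ 0 := by
    have : 4 * lam A * kap A - lam A / 2 ≤ 0 := by nlinarith
    nlinarith
  have hc2 : u ^ 2 * (4 * kap A ^ 2 - kap A) ≤ 0 := by
    have : 4 * kap A ^ 2 - kap A ≤ 0 := by nlinarith
    nlinarith
  have hmain : lam A ^ 2 - 2 * kap A ≤ -gam A := by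
    rw [lam_sq_sub]; linarith [gam_le_gamE_div hA]
  calc wR2 A ξ + (1 / 2) * (ξ + s) * wR1 A ξ
      ≤ wR2 A ξ + (1 / 2) * u * wR1 A ξ := by linarith
    _ = (p ^ 2 - 2 * kap A - (1 / 2) * u * p) * wR A ξ := by rw [hwR2, hwR1]; ring
    _ ≤ -gam A * wR A ξ := by
        refine mul_le_mul_of_nonneg_right ?_ hw.le
        rw [hid]; linarith

/-- **(UW) on `[0, ∞)` for the weight itself.** -/
theorem ineq_of_nonneg (hA : 0 < A) {ξ s : ℝ} (hξ : 0 ≤ ξ) (hs : |s| ≤ A) :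
    gf A ξ + (1 / 2) * (ξ + s) * w1 A ξ ≤ -gam A * wf A ξ := by
  by_cases h : ξ ≤ A
  · rw [gf_of_mem hξ h, w1_of_mem hA hξ h, wf_of_mem hA hξ h]; exact ineq_left hA hξ hs
  · have hge : A ≤ ξ := le_of_not_ge h
    rw [gf_of_ge hA hge, w1_of_ge hA hge, wf_of_ge hA hge]; exact ineq_right hA hge hs

/-! ### Gaussian decay -/

/-- `u·e^{−κu²/2} ≤ 2 + 1/κ` for `u ≥ 0`, `κ > 0` (from `e^y ≥ 1 + y`). -/
theorem mul_exp_neg_sq_le {κ : ℝ} (hκ : 0 < κ) (u : ℝ) : u * Real.exp (-(κ * u ^ 2 / 2)) ≤ 2 + 1 / κ := by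
  have h1 : κ * u ^ 2 / 2 + 1 ≤ Real.exp (κ * u ^ 2 / 2) := Real.add_one_le_exp _
  have hpos : 0 < Real.exp (κ * u ^ 2 / 2) := Real.exp_pos _
  have e : Real.exp (-(κ * u ^ 2 / 2)) = (Real.exp (κ * u ^ 2 / 2))⁻¹ := Real.exp_neg _
  rw [e, ← div_eq_mul_inv, div_le_iff₀ hpos]
  -- `u ≤ (2 + 1/κ)(1 + κu²/2) ≤ (2 + 1/κ)e^{κu²/2}`
  have h2 : u ≤ (2 + 1 / κ) * (κ * u ^ 2 / 2 + 1) := by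
    have e2 : (2 + 1 / κ) * (κ * u ^ 2 / 2 + 1) = 2 + 1 / κ + κ * u ^ 2 + u ^ 2 / 2 := by field_simp; ring
    rw [e2]
    have : 0 < 1 / κ := by positivity
    nlinarith [sq_nonneg (u - 1)]
  have h3 : (2 + 1 / κ) * (κ * u ^ 2 / 2 + 1) ≤ (2 + 1 / κ) * Real.exp (κ * u ^ 2 / 2) :=
    mul_le_mul_of_nonneg_left h1 (by positivity)
  linarith

/-- `(|ξ| − A)² ≥ ξ²/2 − A²`. -/
theorem sq_shift_ge (ξ : ℝ) : ξ ^ 2 / 2 - A ^ 2 ≤ (|ξ| - A) ^ 2 := by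
  have h : (|ξ| - A) ^ 2 - (ξ ^ 2 / 2 - A ^ 2) = (|ξ| - 2 * A) ^ 2 / 2 := by
    have : |ξ| ^ 2 = ξ ^ 2 := sq_abs ξ
    nlinarith [this]
  nlinarith [sq_nonneg (|ξ| - 2 * A)]

/-- Decay of the tail: for `ξ ≥ A`, `w_R(ξ) ≤ e^{κA²}·e^{−(κ/2)ξ²}` and `|w_R′(ξ)| ≤ (4 e^{κA²})·e^{−(κ/4)ξ²}`. -/
theorem wR_le (hA : 0 < A) {ξ : ℝ} (hξA : A ≤ ξ) :
    wR A ξ ≤ Real.exp (kap A * A ^ 2) * Real.exp (-(kap A / 2) * ξ ^ 2) := by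
  have hk := kap_pos hA
  have hξ0 : 0 ≤ ξ := hA.le.trans hξA
  unfold wR qf
  have h1 : WA A * Real.exp (-(lam A * (ξ - A) + kap A * (ξ - A) ^ 2)) ≤ Real.exp (-(kap A * (ξ - A) ^ 2)) := by
    have hW := WA_le_one hA
    have hW0 := WA_pos hA
    have h2 : Real.exp (-(lam A * (ξ - A) + kap A * (ξ - A) ^ 2)) ≤ Real.exp (-(kap A * (ξ - A) ^ 2)) :=
      Real.exp_le_exp.2 (by nlinarith [lam_nonneg hA])
    nlinarith [Real.exp_pos (-(lam A * (ξ - A) + kap A * (ξ - A) ^ 2))]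
  refine h1.trans ?_
  rw [← Real.exp_add]
  refine Real.exp_le_exp.2 ?_
  have h3 := sq_shift_ge (A := A) ξ
  rw [abs_of_nonneg hξ0] at h3
  nlinarith

/-- Decay of the tail slope: `|w_R′(ξ)| ≤ 4e^{κA²}e^{−(κ/4)ξ²}` for `ξ ≥ A`. -/
theorem abs_wR1_le (hA : 0 < A) {ξ : ℝ} (hξA : A ≤ ξ) :
    |wR1 A ξ| ≤ 4 * Real.exp (kap A * A ^ 2) * Real.exp (-(kap A / 4) * ξ ^ 2) := by
  have hk := kap_pos hA
  have hk8 := kap_le hA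
  have hl := lam_le hA
  have hl0 := lam_nonneg hA
  have hξ0 : 0 ≤ ξ := hA.le.trans hξA
  set u := ξ - A with hu
  have hu0 : 0 ≤ u := by rw [hu]; linarith
  have hp0 : 0 ≤ lam A + 2 * kap A * u := by positivity
  have hw := wR_pos hA ξ
  have habs : |wR1 A ξ| = (lam A + 2 * kap A * u) * wR A ξ := by
    unfold wR1
    rw [show ξ - A = u from rfl, abs_mul, abs_neg, abs_of_nonneg hp0, abs_of_pos hw]
  rw [habs]
  -- `wR ≤ e^{−κu²} = e^{−κu²/2}·e^{−κu²/2}` (as `W_A ≤ 1`, `λu ≥ 0`)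
  have hwle : wR A ξ ≤ Real.exp (-(kap A * u ^ 2 / 2)) * Real.exp (-(kap A * u ^ 2 / 2)) := by
    unfold wR qf
    rw [show ξ - A = u from rfl, ← Real.exp_add]
    have h2 : Real.exp (-(lam A * u + kap A * u ^ 2)) ≤ Real.exp (-(kap A * u ^ 2 / 2) + -(kap A * u ^ 2 / 2)) :=
      Real.exp_le_exp.2 (by nlinarith)
    nlinarith [WA_le_one hA, WA_pos hA, Real.exp_pos (-(lam A * u + kap A * u ^ 2))]
  -- `(λ + 2κu)e^{−κu²/2} ≤ λ + 2κ(2 + 1/κ) ≤ 4`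
  have hfac : (lam A + 2 * kap A * u) * Real.exp (-(kap A * u ^ 2 / 2)) ≤ 4 := by
    have h1 := mul_exp_neg_sq_le hk u
    have he1 : Real.exp (-(kap A * u ^ 2 / 2)) ≤ 1 := by
      rw [Real.exp_le_one_iff]; nlinarith
    have he0 := Real.exp_pos (-(kap A * u ^ 2 / 2))
    have e : (lam A + 2 * kap A * u) * Real.exp (-(kap A * u ^ 2 / 2)) =
        lam A * Real.exp (-(kap A * u ^ 2 / 2)) + 2 * kap A * (u * Real.exp (-(kap A * u ^ 2 / 2))) := by ring
    rw [e]
    have : 2 * kap A * (u * Real.exp (-(kap A * u ^ 2 / 2))) ≤ 2 * kap A * (2 + 1 / kap A) :=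
      mul_le_mul_of_nonneg_left h1 (by positivity)
    have e2 : 2 * kap A * (2 + 1 / kap A) = 4 * kap A + 2 := by field_simp; ring
    nlinarith
  -- `e^{−κu²/2} ≤ e^{κA²}·e^{−(κ/4)ξ²}`
  have htail : Real.exp (-(kap A * u ^ 2 / 2)) ≤ Real.exp (kap A * A ^ 2) * Real.exp (-(kap A / 4) * ξ ^ 2) := by
    rw [← Real.exp_add]
    refine Real.exp_le_exp.2 ?_
    have h3 := sq_shift_ge (A := A) ξ
    rw [abs_of_nonneg hξ0, show ξ - A = u from rfl] at h3
    nlinarith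
  have he0 := Real.exp_pos (-(kap A * u ^ 2 / 2))
  calc (lam A + 2 * kap A * u) * wR A ξ
      ≤ (lam A + 2 * kap A * u) * (Real.exp (-(kap A * u ^ 2 / 2)) * Real.exp (-(kap A * u ^ 2 / 2))) :=
        mul_le_mul_of_nonneg_left hwle hp0
    _ = ((lam A + 2 * kap A * u) * Real.exp (-(kap A * u ^ 2 / 2))) * Real.exp (-(kap A * u ^ 2 / 2)) := by ring
    _ ≤ 4 * Real.exp (-(kap A * u ^ 2 / 2)) := mul_le_mul_of_nonneg_right hfac he0.le
    _ ≤ 4 * (Real.exp (kap A * A ^ 2) * Real.exp (-(kap A / 4) * ξ ^ 2)) := by nlinarith [htail]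
    _ = 4 * Real.exp (kap A * A ^ 2) * Real.exp (-(kap A / 4) * ξ ^ 2) := by ring

/-- Decay on `[0,∞)`: `|w| ≤ C e^{−(κ/4)ξ²}` and `|w′| ≤ C e^{−(κ/4)ξ²}` with `C = 4e^{κA²}`. -/
theorem decay_of_nonneg (hA : 0 < A) {ξ : ℝ} (hξ : 0 ≤ ξ) :
    |wf A ξ| ≤ 4 * Real.exp (kap A * A ^ 2) * Real.exp (-(kap A / 4) * ξ ^ 2) ∧
    |w1 A ξ| ≤ 4 * Real.exp (kap A * A ^ 2) * Real.exp (-(kap A / 4) * ξ ^ 2) := by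
  have hk := kap_pos hA
  -- on `[0,A]` the Gaussian factor is `≥ e^{−(κ/4)A²}` and `e^{κA²}·e^{−(κ/4)A²} ≥ 1`
  by_cases h : ξ ≤ A
  · have hlow : 1 ≤ Real.exp (kap A * A ^ 2) * Real.exp (-(kap A / 4) * ξ ^ 2) := by
      rw [← Real.exp_add]
      refine Real.one_le_exp ?_
      nlinarith [mul_le_mul h h hξ hA.le]
    have hw : |wf A ξ| ≤ 1 := by
      rw [wf_of_mem hA hξ h, abs_of_pos (wL_pos hA hξ h)]; exact wL_le_one hA ξ
    have hw1 : |w1 A ξ| ≤ 1 := by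
      rw [w1_of_mem hA hξ h]
      have h1 : |(-gam A) * hf A ξ| = gam A * hf A ξ := by
        rw [abs_mul, abs_neg, abs_of_pos (gam_pos (A := A)), abs_of_nonneg (hf_nonneg hA hξ)]
      rw [h1]
      -- `γ h(ξ) ≤ γ h(A) ≤ 1/8`
      have hmono : hf A ξ ≤ hf A A := by
        unfold hf
        refine mul_le_mul_of_nonneg_left ?_ (by positivity)
        have := Real.exp_le_exp.2 (show A * ξ / 2 ≤ A * A / 2 by nlinarith)
        linarith
      have := gam_hf_le hA
      have := gam_pos (A := A)
      nlinarith
    constructor <;> nlinarith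
  · have hge : A ≤ ξ := le_of_not_ge h
    refine ⟨?_, ?_⟩
    · rw [wf_of_ge hA hge, abs_of_pos (wR_pos hA ξ)]
      have h1 := wR_le hA hge
      have h2 : Real.exp (-(kap A / 2) * ξ ^ 2) ≤ Real.exp (-(kap A / 4) * ξ ^ 2) :=
        Real.exp_le_exp.2 (by nlinarith [sq_nonneg ξ])
      have h3 := Real.exp_pos (kap A * A ^ 2)
      have h4 : 1 ≤ Real.exp (kap A * A ^ 2) := Real.one_le_exp (by positivity)
      nlinarith [Real.exp_pos (-(kap A / 4) * ξ ^ 2)]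
    · rw [w1_of_ge hA hge]; exact abs_wR1_le hA hge

/-! ### The main theorem -/

/-- **AN EXPLICIT UNIVERSAL LYAPUNOV WEIGHT FOR (OSC) IN SIMILARITY VARIABLES.**  For every `A > 0` there are `γ > 0`, `κ > 0`, `C ≥ 0`
and an even `C²` function `w : ℝ → ℝ`, positive, non-increasing on `[0,∞)`, such that for every `ξ ∈ ℝ` and every `s` with `|s| ≤ A`
`w″(ξ) + ½(ξ + s)·w′(ξ) ≤ −γ·w(ξ)`, and `|w(ξ)|, |w′(ξ)| ≤ C·e^{−κξ²}`.  (Here `γ = e^{−A²/2}/16`; no spectral theory: the weight is the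
explicit `C²` gluing of `1 − γH` on `[0,A]` with a Gaussian tail.)  This is the hypothesis object of the ancient Liouville theorem for
(OSC) (port-2's (K-b)/(K-c)); `A = 2N` for a class profile with hot-spot constant `N`. -/
theorem exists_universalWeight {A : ℝ} (hA : 0 < A) :
    ∃ γ κ C : ℝ, 0 < γ ∧ 0 < κ ∧ 0 ≤ C ∧ ∃ w : ℝ → ℝ, ContDiff ℝ 2 w ∧ (∀ ξ, w (-ξ) = w ξ) ∧ (∀ ξ, 0 < w ξ) ∧
      (∀ ξ, 0 ≤ ξ → deriv w ξ ≤ 0) ∧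
      (∀ ξ s : ℝ, |s| ≤ A → deriv (deriv w) ξ + (1 / 2) * (ξ + s) * deriv w ξ ≤ -γ * w ξ) ∧
      (∀ ξ, |w ξ| ≤ C * Real.exp (-κ * ξ ^ 2)) ∧ (∀ ξ, |deriv w ξ| ≤ C * Real.exp (-κ * ξ ^ 2)) := by
  refine ⟨gam A, kap A / 4, 4 * Real.exp (kap A * A ^ 2), gam_pos, by linarith [kap_pos hA], by positivity,
    wf A, contDiff_two_wf hA, wf_even, ?_, ?_, ?_, ?_, ?_⟩
  · -- positivity (evenness for `ξ < 0`)
    intro ξ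
    rcases le_or_gt 0 ξ with h | h
    · exact wf_pos_of_nonneg hA h
    · rw [← wf_even ξ]; exact wf_pos_of_nonneg hA (by linarith)
  · intro ξ hξ
    rw [deriv_wf hA]; exact w1_nonpos_of_nonneg hA hξ
  · -- (UW) on all of `ℝ`: for `ξ < 0` use `w″` even, `w′` odd and `s ↦ −s`
    intro ξ s hs
    rw [deriv_wf hA, deriv_w1 hA]
    rcases le_or_gt 0 ξ with h | h
    · exact ineq_of_nonneg hA h hs
    · have hs' : |(-s)| ≤ A := by rwa [abs_neg]
      have h1 := ineq_of_nonneg hA (show 0 ≤ -ξ by linarith) hs'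
      rw [gf_even, w1_odd, wf_even] at h1
      have e : (1 / 2) * (-ξ + -s) * -w1 A ξ = (1 / 2) * (ξ + s) * w1 A ξ := by ring
      rw [e] at h1
      exact h1
  · intro ξ
    rcases le_or_gt 0 ξ with h | h
    · have h1 := (decay_of_nonneg hA h).1
      simpa [neg_mul] using h1
    · have h1 := (decay_of_nonneg hA (show 0 ≤ -ξ by linarith)).1
      rw [wf_even] at h1
      simpa [neg_mul] using h1
  · intro ξ
    rw [deriv_wf hA]
    rcases le_or_gt 0 ξ with h | h
    · have h1 := (decay_of_nonneg hA h).2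
      simpa [neg_mul] using h1
    · have h1 := (decay_of_nonneg hA (show 0 ≤ -ξ by linarith)).2
      rw [w1_odd, abs_neg] at h1
      simpa [neg_mul] using h1

end Summit.NavierStokesRegularity.NavierStokesRegularity.Theorems.PoloidalWindowDoorLrcModEntireTwistingTHOscUniversalWeight
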